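import Summits.BirchSwinnertonDyer.BirchSwinnertonDyer.Theorems.ManinLocalTwoThreePinningOneTwentySixRows
import Summits.BirchSwinnertonDyer.BirchSwinnertonDyer.Theorems.ManinLocalTwoThreeOddTwistRootFormTransport
import Summits.BirchSwinnertonDyer.BirchSwinnertonDyer.Theorems.ManinLocalTwoThreeRootFormFortyTwo
import Summits.BirchSwinnertonDyer.BirchSwinnertonDyer.Theorems.ManinLocalTwoThreeManinConstantFourteen
import Literature.NumberTheory.EllipticCurves.OrdinaryPrimesProofs
import HarnessLib

/-!
# LEVEL 126 = 2·3²·7 COMPLETE, fact-free: `|c| = 1` (hence `3 ∤ c`) for every lattice-optimal `X₀(126)`-datum — a C3 level (`9 ∥ N`)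
# reached by the ODD-TWIST ROOT-FORM TRANSPORT from the fact-free semistable roots `14` and `42`

Cell bsd-f2-manin, route `ManinLocalTwoThree`, crux C3 `ManinPrimeToThreeAtNine` (stmt-BirchSwinnertonDyer-22968; also C2's sibling shape file),
prover seat p3 gen 26.  Inputs, all in the tree and all fact-free:
* an g55's level-126 pinning + rows (`…PinningOneTwentySix{Tables,TablesB,,Rows}`): for every `X₀(126)`-datum `D`, `a₂(W) ∈ {−1, 1}` and
  `a₂(W) = 1 ⇒ D.f = (φ₁₄) ⊗ χ₋₃` (`126a`, EXPLICIT root `φ₁₄ = η₁η₂η₇η₁₄`), while the `126b` row (`a₂(W) = −1`) is there identified relative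
  to a root DATUM `D₄₂`;
* THIS SEAT's datum-free root form at `42` (`…RootFormFortyTwo`: the newform combination `F₄₂` is a CUSP form with `aₙ(F₄₂) = aₙ(42a1)`, `n < 97`,
  and `Λ(F₄₂) ⊆ Λ_Néron(42a1)` by the Bracket–Sturm certificate at form level; `42a1` multiplicative at `3`);
* p3 g25's root `14` (`…ManinConstantFourteen`: `Λ(φ₁₄) ⊆ Λ_Néron(14a1)`, `14a1 = [1,0,1,4,−6]` globally minimal);
* THIS SEAT's engine (`…OddTwistRootFormTransport`): THEOREM 68.A WITHOUT A ROOT DATUM.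

CONTENTS.  §1 `14a1` is good at `3`.  §2 the `126b` row re-keyed to the datum-free root form: `a₂(W) = −1 ⇒ D.f = F₄₂ ⊗ χ₋₃`
(`f_eq_charTwist_rootForm_of_lFunction_two`; an's row lemma `PinningKernelRows.eq_of_smul_eq_sum_of_row` with the root table supplied by
`exists_rootForm_fortyTwo` instead of `PinningFortyTwo.pinning D₄₂`).  §3 THE HEADLINE **`abs_maninConstant_eq_one_oneTwentySix`**: `|c(D)| = 1`
for every globally minimal elliptic `W/ℚ` and every `X₀(126)`-datum `D` with the lattice clause — both rows by
`OddTwistRootForm.abs_maninConstant_eq_one_of_rootForm_charTwist_eq` at `p = 3`; corollaries `not_dvd_maninConstant_oneTwentySix`, the crux shape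
`maninPrimeToThreeAtNine_oneTwentySix` (`3² ∣ 126 ∧ ∀ …, |c| = 1 ∧ 3 ∤ c`).

HONEST FRAMING: unconditional (standard axioms): no root datum, no modularity (`exists_isNewformOf`), no CDT, no printed Manin fact, no Cremona
table.  It is ONE LEVEL of the C3 domain; nothing here proves C3 (∀ N), C2, Manin's conjecture or BSD; items 22967/22968 stay OPEN.
No definition, no named fact, no sorry.
[cite: Stevens1989, Lemma (5.2) p. 96, Lemma (5.4) p. 97] [cite: Shimura1971, Prop. 3.64] [cite: AgasheRibetStein2006, §§1–2]
[cite: CremonaAlgorithms1997, §2.10 and Table 1 (14a1, 42a1, 126a1, 126b1)] [cite: SilvermanAEC2009, VII.5 Prop. 5.1]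
-/

set_option autoImplicit false
-- lint-debt: the directory name repeats the summit name (sibling precedent `ManinLocalTwoThreeManinConstantFortyTwo.lean`)
set_option linter.dupNamespace false

noncomputable section

open Complex
open UpperHalfPlane hiding I
open scoped MatrixGroups ModularForm
open ModularForm CongruenceSubgroup PowerSeries
open Literature.NumberTheory.ModularForms
open Literature.NumberTheory.EllipticCurves Literature.NumberTheory.EllipticCurves.ModularForms

namespace Summit.BirchSwinnertonDyer.BirchSwinnertonDyer.Theorems.ManinLocalTwoThree.LevelOneTwentySix

open Summit.BirchSwinnertonDyer.BirchSwinnertonDyer.Theorems.ManinLocalTwoThree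
open BracketSturm PinningKernel PinningOneTwentySix OddTwistRootForm

set_option maxHeartbeats 4000000
set_option maxRecDepth 16384

variable {W : WeierstrassCurve ℚ} [W.IsElliptic]

/-! ## §1 The root curve `14a1 = [1, 0, 1, 4, −6]` is good at `3` -/

/-- `Δ_min(14a1) = −21952 = −2⁶·7³`. [cite: CremonaAlgorithms1997, Table 1 (14a1)] -/
theorem minimalDiscriminantInt_W14 [(⟨1, 0, 1, 4, -6⟩ : WeierstrassCurve ℚ).IsGloballyMinimal] :
    WeierstrassCurve.minimalDiscriminantInt (⟨1, 0, 1, 4, -6⟩ : WeierstrassCurve ℚ) = -21952 := by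
  have h : ((WeierstrassCurve.minimalDiscriminantInt (⟨1, 0, 1, 4, -6⟩ : WeierstrassCurve ℚ) : ℤ) : ℚ) = ((-21952 : ℤ) : ℚ) := by
    rw [WeierstrassCurve.cast_minimalDiscriminantInt, LevelFourteen.Δ_W14]; norm_num
  exact_mod_cast h

/-- **`14a1` has good reduction at `3`** (`3 ∤ Δ_min = −2⁶·7³`). [cite: SilvermanAEC2009, VII.5 Prop. 5.1] [cite: CremonaAlgorithms1997, Table 1 (14a1)] -/
theorem hasGoodReductionAtPrime_three_W14 [Fact (Nat.Prime 3)] [(⟨1, 0, 1, 4, -6⟩ : WeierstrassCurve ℚ).IsGloballyMinimal] :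
    (⟨1, 0, 1, 4, -6⟩ : WeierstrassCurve ℚ).HasGoodReductionAtPrime 3 := by
  refine WeierstrassCurve.hasGoodReductionAtPrime_of_not_dvd _ 3 ?_
  rw [minimalDiscriminantInt_W14]
  decide

/-! ## §2 The `126b` row with the datum-free root form `F₄₂` -/

/-- The first `64` entries of the `97`-term table of `aₙ(42a1)` are an's `tab42a` (kernel check). [folklore] -/
theorem tab42a_eq_take : ∀ n < 64, tab42a.getD n 0 = ([0, 1, 1, -1, 1, -2, -1, -1, 1, 1, -2, -4, -1, 6, -1, 2, 1, 2, 1, -4, -2, 1, -4, 8, -1, -1, 6, -1, -1, -2, 2, 0, 1, 4, 2, 2, 1, -10, -4, -6, -2, -6, 1, -4, -4, -2, 8, 0, -1, 1, -1, -2, 6, 6, -1, 8, -1, 4, -2, 4, 2, 6, 0, -1, 1, -12, 4, 4, 2, -8, 2, 8, 1, 10, -10, 1, -4, 4, -6, 0, -2, 1, -6, -4, 1, -4, -4, 2, -4, -6, -2, -6, 8, 0, 0, 8, -1] : List ℤ).getD n 0 := by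
  decide

/-- **`aₙ(F) = tab42a[n]`, `n < 64`, for the datum-free root form** (any cusp form `F` on `Γ₀(42)` with the `97`-term table of `42a1`).
[cite: CremonaAlgorithms1997, Table 1 (42a1)] -/
theorem tab42a_eq_cuspCoeff_rootForm (F : CuspForm (Gamma0 42) 2)
    (hF : ∀ n < 97, ((([0, 1, 1, -1, 1, -2, -1, -1, 1, 1, -2, -4, -1, 6, -1, 2, 1, 2, 1, -4, -2, 1, -4, 8, -1, -1, 6, -1, -1, -2, 2, 0, 1, 4, 2, 2, 1, -10, -4, -6, -2, -6, 1, -4, -4, -2, 8, 0, -1, 1, -1, -2, 6, 6, -1, 8, -1, 4, -2, 4, 2, 6, 0, -1, 1, -12, 4, 4, 2, -8, 2, 8, 1, 10, -10, 1, -4, 4, -6, 0, -2, 1, -6, -4, 1, -4, -4, 2, -4, -6, -2, -6, 8, 0, 0, 8, -1] : List ℤ).getD n 0 : ℤ) : ℂ) = cuspCoeff F n) :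
    ∀ n < 64, ((tab42a.getD n 0 : ℤ) : ℂ) = cuspCoeff F n := by
  intro n hn
  rw [tab42a_eq_take n hn]
  exact hF n (by omega)

/-- **`aₙ(F ⊗ χ₋₃) = tabTb[n]` for `n < 64`**, `F` the datum-free root form (an's `tabTb_eq_modCoef_charTwist` re-keyed). [cite: Shimura1971, Prop. 3.64] -/
theorem tabTb_eq_modCoef_charTwist_rootForm (F : CuspForm (Gamma0 42) 2)
    (hF64 : ∀ n < 64, ((tab42a.getD n 0 : ℤ) : ℂ) = cuspCoeff F n) :
    ∀ n < 64, ((tabTb.getD n 0 : ℤ) : ℂ) = modCoefₗ 126 2 n (ModularFormClass.modularForm (charTwist 126 (⟨3, rfl⟩ : 42 ∣ 126) (⟨14, rfl⟩ : 3 ^ 2 ∣ 126) (isQuadratic_quadraticChar_ringHomComp 3) F)) := by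
  intro n hn
  have hc : ((tabTb.getD n 0 : ℤ) : ℂ) = ((legendreSym 3 n : ℤ) : ℂ) * ((tab42a.getD n 0 : ℤ) : ℂ) := by
    exact_mod_cast hTwb n hn
  rw [modCoefₗ_modularForm, cuspCoeff_charTwist 126 _ _ (isQuadratic_quadraticChar_ringHomComp 3)
    (isPrimitive_quadraticChar_ringHomComp 3 (by norm_num)), quadraticChar_ringHomComp_apply_natCast, ← hF64 n hn]
  exact hc

/-- **The `126b` row with the DATUM-FREE root form**: `a₂(W) = −1 ⇒ D.f = F ⊗ χ₋₃` for every cusp form `F` on `Γ₀(42)` with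
`aₙ(F) = aₙ(42a1)` (`n < 64`) — an's pinning + row lemma, root table from the form instead of from an `X₀(42)`-datum.
[cite: CremonaAlgorithms1997, §2.10, Table 1 (126b, 42a)] [cite: Shimura1971, Prop. 3.64] -/
theorem f_eq_charTwist_rootForm_of_lFunction_two (F : CuspForm (Gamma0 42) 2)
    (hF64 : ∀ n < 64, ((tab42a.getD n 0 : ℤ) : ℂ) = cuspCoeff F n)
    (D : ModularParametrizationData W 126) (h2 : W.LFunction 2 = -1) :
    D.f = charTwist 126 (⟨3, rfl⟩ : 42 ∣ 126) (⟨14, rfl⟩ : 3 ^ 2 ∣ 126) (isQuadratic_quadraticChar_ringHomComp 3) F := by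
  haveI : FiniteDimensional ℂ (ModularForm (Gamma0 126) 2) := Module.finite_of_finrank_eq_succ finrank_modularForm_two
  obtain ⟨C, hC, c, hc, htruth, hpin⟩ := pinning D
  have ht := tables_of_etaCertsSparse 126 64 (fun i : Fin 32 ↦ expFn (Ls[(i : ℕ)]).1) (fun i ↦ shifts i) tabs C hC hshift hcert
  rw [stages_map_fst] at htruth
  rw [goodCerts_eq_rows] at hc
  simp only [List.mem_cons, List.mem_nil_iff, or_false] at hc
  rcases hc with rfl | rfl
  · exact cuspForm_eq_of_modularForm_eq (eq_of_smul_eq_sum_of_row C tabs duals 63921312 ht hlen hdual (by norm_num)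
      finrank_modularForm_two _ tabTb (tabTb_eq_modCoef_charTwist_rootForm F hF64) rowB.2.1 (by decide) rowB.2.2 hpin hrowB)
  · have h' := lFunction_two_of_truth rowA htruth
    simp only [rowA, List.getD_cons_succ, List.getD_cons_zero] at h'
    rw [h2] at h'
    norm_num at h'

/-! ## §3 The headline: `|c| = 1` on `X₀(126)`, unconditionally -/

/-- **LEVEL 126 COMPLETE — `|c| = 1` for every globally minimal elliptic `W/ℚ` and every `X₀(126)`-datum with the lattice clause**
(the shape `LevelManinOne 126`).  Row `126a` (`a₂(W) = 1`): `D.f = φ₁₄ ⊗ χ₋₃`, root squeeze `Λ(φ₁₄) ⊆ Λ_Néron(14a1)`, `14a1` good at `3`;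
row `126b` (`a₂(W) = −1`): `D.f = F₄₂ ⊗ χ₋₃`, root squeeze `Λ(F₄₂) ⊆ Λ_Néron(42a1)`, `42a1` multiplicative at `3`; both closed by the
odd-twist ROOT-FORM transport (Stevens (5.2) PROVED + `Γ₀` twisting + Néron squeeze).  No root datum, no modularity, no CDT, no printed fact.
[cite: Stevens1989, Lemma (5.2) p. 96, Lemma (5.4) p. 97] [cite: AgasheRibetStein2006, §§1–2] [cite: CremonaAlgorithms1997, Table 1 (126a1, 126b1)] -/
theorem abs_maninConstant_eq_one_oneTwentySix (W : WeierstrassCurve ℚ) [W.IsElliptic] [W.IsGloballyMinimal]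
    (D : ModularParametrizationData W 126) (hopt : ∀ z ∈ D.L.lattice, ∃ w ∈ periodLattice D.f, z = D.c * w) :
    |D.maninConstant| = 1 := by
  haveI h3 : Fact (Nat.Prime 3) := ⟨by norm_num⟩
  rcases lFunction_two_cases D with h2 | h2
  · -- row `126b = 42a ⊗ χ₋₃`: the datum-free root form of level `42`
    obtain ⟨F, hF97, hS⟩ := LevelFortyTwo.exists_rootForm_fortyTwo
    haveI := LevelFortyTwo.isElliptic_fortyTwoA1
    haveI := LevelFortyTwo.isGloballyMinimal_fortyTwoA1
    obtain ⟨L₀, hg2, hg3⟩ := ((⟨1, 1, 1, -4, 5⟩ : WeierstrassCurve ℚ).baseChange ℂ).exists_periodPair_of_isElliptic'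
    have hL₀ : IsNeronLatticeOf ((⟨1, 1, 1, -4, 5⟩ : WeierstrassCurve ℚ).baseChange ℂ) L₀ := ⟨hg2, hg3⟩
    exact abs_maninConstant_eq_one_of_rootForm_charTwist_eq (p := 3) (by norm_num) (isQuadratic_quadraticChar_ringHomComp 3)
      (isPrimitive_quadraticChar_ringHomComp 3 (by norm_num)) F (⟨1, 1, 1, -4, 5⟩ : WeierstrassCurve ℚ) L₀ hL₀ (hS L₀ hL₀)
      (Or.inr LevelFortyTwo.hasMultiplicativeReductionAtPrime_three_fortyTwoA1) W D _ _
      (f_eq_charTwist_rootForm_of_lFunction_two F (tab42a_eq_cuspCoeff_rootForm F hF97) D h2) hopt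
  · -- row `126a = 14a ⊗ χ₋₃`: the explicit root form `φ₁₄`
    obtain ⟨L₁, hg2, hg3, hle⟩ := LevelFourteen.periodLatticeLe_fourteen
    haveI := LevelFourteen.isElliptic_W14
    haveI := LevelFourteen.isGloballyMinimal_W14
    exact abs_maninConstant_eq_one_of_rootForm_charTwist_eq (p := 3) (by norm_num) (isQuadratic_quadraticChar_ringHomComp 3)
      (isPrimitive_quadraticChar_ringHomComp 3 (by norm_num)) cuspFormEta14 (⟨1, 0, 1, 4, -6⟩ : WeierstrassCurve ℚ) L₁
      (LevelFourteen.isNeronLatticeOf_W14 hg2 hg3) hle (Or.inl hasGoodReductionAtPrime_three_W14) W D _ _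
      (f_eq_charTwist_fourteen_of_lFunction_two D h2) hopt

/-- **Corollary: no integer `p` with `|p| ≠ 1` — in particular neither `3` nor `2` nor any prime — divides the Manin constant of a
lattice-optimal `X₀(126)`-datum.** [folklore] -/
theorem not_dvd_maninConstant_oneTwentySix (W : WeierstrassCurve ℚ) [W.IsElliptic] [W.IsGloballyMinimal]
    (D : ModularParametrizationData W 126) (hopt : ∀ z ∈ D.L.lattice, ∃ w ∈ periodLattice D.f, z = D.c * w)
    {p : ℤ} (hp : p.natAbs ≠ 1) : ¬ p ∣ D.maninConstant := by
  intro h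
  have h1 := abs_maninConstant_eq_one_oneTwentySix W D hopt
  have hn : D.maninConstant.natAbs = 1 := by
    rw [Int.abs_eq_natAbs] at h1
    exact_mod_cast h1
  have h2 : p.natAbs ∣ 1 := hn ▸ Int.natAbs_dvd_natAbs.mpr h
  exact hp (Nat.dvd_one.mp h2)

/-- **C3 `ManinPrimeToThreeAtNine` AT THE LEVEL `N = 126`, with NONE of its printed hypotheses**: `3² ∣ 126` and every lattice-optimal
`X₀(126)`-datum of every globally minimal elliptic curve has `|c| = 1` and `3 ∤ c`. [cite: CremonaAlgorithms1997, Table 1 (126a1, 126b1)] -/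
theorem maninPrimeToThreeAtNine_oneTwentySix : 3 ^ 2 ∣ 126 ∧
    ∀ (W : WeierstrassCurve ℚ) [W.IsElliptic] [W.IsGloballyMinimal] (D : ModularParametrizationData W 126),
      (∀ z ∈ D.L.lattice, ∃ w ∈ periodLattice D.f, z = D.c * w) →
        |D.maninConstant| = 1 ∧ ¬ (3 : ℤ) ∣ D.maninConstant :=
  ⟨by norm_num, fun W _ _ D hopt ↦
    ⟨abs_maninConstant_eq_one_oneTwentySix W D hopt, not_dvd_maninConstant_oneTwentySix W D hopt (by decide)⟩⟩

/-- **The sieve truth rows read back**: every curve with an `X₀(126)`-datum is ADDITIVE at `3` in the `L`-coefficient sense (`a₃(W) = 0`) and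
multiplicative at `2` and `7` (`a₂(W), a₇(W) ∈ {±1}`). [cite: CremonaAlgorithms1997, Table 1 (126a1, 126b1)] -/
theorem lFunction_three_eq_zero (D : ModularParametrizationData W 126) : W.LFunction 3 = 0 := by
  haveI : FiniteDimensional ℂ (ModularForm (Gamma0 126) 2) := Module.finite_of_finrank_eq_succ finrank_modularForm_two
  obtain ⟨C, hC, c, hc, htruth, -⟩ := pinning D
  rw [stages_map_fst] at htruth
  rw [goodCerts_eq_rows] at hc
  simp only [List.mem_cons, List.mem_nil_iff, or_false] at hc
  have h' := congrArg (fun l : List (ℕ × ℤ) ↦ (l.getD 0 (0, 0)).2) htruth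
  rcases hc with rfl | rfl
  · simpa [truth, rowB] using h'
  · simpa [truth, rowA] using h'

end Summit.BirchSwinnertonDyer.BirchSwinnertonDyer.Theorems.ManinLocalTwoThree.LevelOneTwentySix

end
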